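import Summits.QuantumAdvantage.QuantumAdvantage.Theorems.CubicForrelationNearExactIsExactAmmCeilingX

/-!
# Crux `CubicForrelation.NearExactIsExact` (stmt-QuantumAdvantage-14043) — almost-MM ceiling, part Y:
Walsh transforms of the slices (off and on the zero locus `Z`), the CORNERS and the second wall

Line `direct-sum-amplification`, lead c3 (third helper file for the registered stub `stub_ammCeiling`).
Setting as in parts Q, X: `f` cubic on `a + (a+2)` bits with quadratic slices `c_{x₁} = f(x₁ ‖ ·)`, polar
entries `B_{ij}(x₁)` satisfying Plücker at every `x₁`.  If `B_{pq}(x₁) = 1` the slice is the aligned quadratic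
`(r_p·x)(r_q·x) ⊕ a′·x ⊕ f(x₁‖0)` (rows `r_p, r_q`, corner `a′_j = f(x₁‖e_j) ⊕ f(x₁‖0) ⊕ B_{pj}B_{qj}`), so
`|W_{c_{x₁}}| = 2^{a+2}/2` exactly on the four CORNERS `a′ ⊕ σ r_p ⊕ τ r_q` and `0` elsewhere
(`acy_absW_offZ`), whence the fibre sum `Σ_{y ∈ φ⁻¹(x₁)} (−1)^{h y} W ≤ 2·2^{a+2}` (`acy_gamma_offZ`); if all
`B_{ij}(x₁) = 0` the slice is affine and the fibre sum is `≤ 2^{a+2}` (`acy_gamma_onZ`).  At a GOOD fibre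
(four-point lemma) the corners ARE the fibre; the functions `B_{pq}(x₁)·[φ(corner_{στ}(x₁))_i ≠ (x₁)_i]` have
degree `≤ 5` in `x₁`, so with fewer than `2^a/32` bad fibres they vanish identically: every corner of every
`x₁` with `B_{pq}(x₁) = 1` lies in the fibre `φ⁻¹(x₁)` (`acy_corner_mem`, the second wall).

References: C. Carlet, *Boolean Functions for Cryptography and Coding Theory* (CUP 2021), §5.1;
F. J. MacWilliams, N. J. A. Sloane, *The Theory of Error-Correcting Codes* (1977), Ch. 13.
-/

set_option linter.dupNamespace false -- D-0017: single-problem summit ⇒ `QuantumAdvantage.QuantumAdvantage` by design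

noncomputable section

namespace Summit.QuantumAdvantage.QuantumAdvantage.Theorems.CubicForrelation.NearExactIsExact

open Finset
open Literature.Computability.QuantumComplexity
open Literature.Computability.QuantumComplexity.BuzetChailloux (bxor zeroVec signOf_sq bxor_zeroVec zeroVec_bxor
  bxor_comm bxor_self bxor_bxor_cancel_left twist_zeroVec_right twist_bxor_right sum_twist_left bxor_eq_zeroVec_iff)
open Literature.Computability.QuantumComplexity.DerivativeWalsh (W signOf_not)

variable {a : ℕ}

/-! ### The aligned Walsh transform in absolute value -/

/-- For the aligned quadratic with independent `u, v`: `|W(y)| = 2^k/2` on the four corners and `0` elsewhere.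
[cite: Carlet2020, §5.1] -/
theorem acy_W_aligned_abs {k : ℕ} (l : (Fin k → Bool) → (Fin k → Bool) → Bool) (hl : ∀ y x, signOf (l y x) = twist x y)
    {c : (Fin k → Bool) → Bool} {u v s : Fin k → Bool} {e : Bool} (hc : ∀ x, c x = ((l u x && l v x) ^^ l s x ^^ e))
    (hu : u ≠ zeroVec) (hv : v ≠ zeroVec) (huv : u ≠ v) (y : Fin k → Bool) :
    |W (fun x => signOf (c x)) y| =
      if y ∈ ({s, bxor s u, bxor s v, bxor s (bxor u v)} : Finset (Fin k → Bool)) then (2 : ℝ) ^ k / 2 else 0 := by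
  rw [acq_W_aligned' l hl hc y]
  have hse : |signOf e| = 1 := abs_signOf e
  have hpos : (0 : ℝ) < 2 ^ k / 2 := by positivity
  -- the four corners are distinct
  have d1 : s ≠ bxor s u := fun h => hu (by
    have := congrArg (bxor s) h; rwa [bxor_self, bxor_bxor_cancel_left, eq_comm] at this)
  have d2 : s ≠ bxor s v := fun h => hv (by
    have := congrArg (bxor s) h; rwa [bxor_self, bxor_bxor_cancel_left, eq_comm] at this)
  have d3 : s ≠ bxor s (bxor u v) := fun h => huv (by
    have := congrArg (bxor s) h
    rw [bxor_self, bxor_bxor_cancel_left, eq_comm, bxor_eq_zeroVec_iff] at this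
    exact this)
  have d4 : bxor s u ≠ bxor s v := fun h => huv (by
    have := congrArg (bxor s) h; rwa [bxor_bxor_cancel_left, bxor_bxor_cancel_left] at this)
  have d5 : bxor s u ≠ bxor s (bxor u v) := fun h => hv (by
    have := congrArg (bxor s) h
    rw [bxor_bxor_cancel_left, bxor_bxor_cancel_left] at this
    have := congrArg (bxor u) this
    rwa [bxor_self, bxor_bxor_cancel_left, eq_comm] at this)
  have d6 : bxor s v ≠ bxor s (bxor u v) := fun h => hu (by
    have := congrArg (bxor s) h
    rw [bxor_bxor_cancel_left, bxor_bxor_cancel_left, bxor_comm u v] at this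
    have := congrArg (bxor v) this
    rwa [bxor_self, bxor_bxor_cancel_left, eq_comm] at this)
  simp only [mem_insert, mem_singleton]
  by_cases h1 : y = s
  · subst h1
    rw [if_pos rfl, if_neg d1, if_neg d2, if_neg d3, if_pos (Or.inl rfl), abs_mul, abs_mul, hse]
    norm_num [abs_of_pos hpos]
  by_cases h2 : y = bxor s u
  · subst h2
    rw [if_neg h1, if_pos rfl, if_neg d4, if_neg d5, if_pos (Or.inr (Or.inl rfl)), abs_mul, abs_mul, hse]
    norm_num [abs_of_pos hpos]
  by_cases h3 : y = bxor s v
  · subst h3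
    rw [if_neg h1, if_neg h2, if_pos rfl, if_neg d6, if_pos (Or.inr (Or.inr (Or.inl rfl))), abs_mul, abs_mul, hse]
    norm_num [abs_of_pos hpos]
  by_cases h4 : y = bxor s (bxor u v)
  · subst h4
    rw [if_neg h1, if_neg h2, if_neg h3, if_pos rfl, if_pos (Or.inr (Or.inr (Or.inr rfl))), abs_mul, abs_mul, hse]
    norm_num [abs_of_pos hpos]
  · rw [if_neg h1, if_neg h2, if_neg h3, if_neg h4, if_neg (fun h => by rcases h with h | h | h | h <;> contradiction)]
    norm_num

/-- A signed sum over a finset is at most the corner mass: if `|w y| = [y ∈ C]·M` with `|C| ≤ 4`, then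
`Σ_{y∈S} σ_y w_y ≤ 4M` for any `±1` signs. [folklore] -/
theorem acy_sum_le_of_abs {α : Type*} [DecidableEq α] (S C : Finset α) (w σ : α → ℝ) (M : ℝ) (hM : 0 ≤ M)
    (hσ : ∀ y, |σ y| = 1) (hw : ∀ y, |w y| = if y ∈ C then M else 0) (hC : C.card ≤ 4) :
    ∑ y ∈ S, σ y * w y ≤ 4 * M := by
  calc ∑ y ∈ S, σ y * w y ≤ ∑ y ∈ S, |σ y * w y| := sum_le_sum fun y _ => le_abs_self _
    _ = ∑ y ∈ S, (if y ∈ C then M else 0) := sum_congr rfl fun y _ => by rw [abs_mul, hσ, hw, one_mul]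
    _ = ((S.filter fun y => y ∈ C).card : ℝ) * M := by rw [← sum_filter, sum_const, nsmul_eq_mul]
    _ ≤ (C.card : ℝ) * M := by
        refine mul_le_mul_of_nonneg_right ?_ hM
        exact_mod_cast card_le_card (fun y hy => (mem_filter.1 hy).2)
    _ ≤ 4 * M := by
        refine mul_le_mul_of_nonneg_right ?_ hM
        exact_mod_cast hC

/-! ### The slice off the zero locus: normal form, Walsh values, fibre sum -/

section OffZ

variable (l : (Fin (a + 2) → Bool) → (Fin (a + 2) → Bool) → Bool)
  {f : (Fin (a + (a + 2)) → Bool) → Bool} (x₁ : Fin a → Bool) (p q : Fin (a + 2))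

/-- The normal form of the slice `c_{x₁}` when Plücker holds and `B_{pq}(x₁) = 1`: rows `r_p, r_q`, corner `a′`,
constant `f(x₁‖0)`.  (A restatement of `acq_normalForm` for the slice.) [cite: Carlet2020, §5.1] -/
theorem acy_slice_normalForm (hl : ∀ y x, signOf (l y x) = twist x y)
    (hq : IsDegLeFun 2 (fun x₂ : Fin (a + 2) → Bool => f (Fin.append x₁ x₂)))
    (hP : ∀ i j i' j' : Fin (a + 2),
      (((f (Fin.append x₁ zeroVec) ^^ f (Fin.append x₁ (Pi.single i true)) ^^ f (Fin.append x₁ (Pi.single j true)) ^^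
            f (Fin.append x₁ (bxor (Pi.single i true) (Pi.single j true)))) &&
          (f (Fin.append x₁ zeroVec) ^^ f (Fin.append x₁ (Pi.single i' true)) ^^ f (Fin.append x₁ (Pi.single j' true)) ^^
            f (Fin.append x₁ (bxor (Pi.single i' true) (Pi.single j' true))))) ^^
        ((f (Fin.append x₁ zeroVec) ^^ f (Fin.append x₁ (Pi.single i true)) ^^ f (Fin.append x₁ (Pi.single i' true)) ^^
            f (Fin.append x₁ (bxor (Pi.single i true) (Pi.single i' true)))) &&
          (f (Fin.append x₁ zeroVec) ^^ f (Fin.append x₁ (Pi.single j true)) ^^ f (Fin.append x₁ (Pi.single j' true)) ^^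
            f (Fin.append x₁ (bxor (Pi.single j true) (Pi.single j' true))))) ^^
        ((f (Fin.append x₁ zeroVec) ^^ f (Fin.append x₁ (Pi.single i true)) ^^ f (Fin.append x₁ (Pi.single j' true)) ^^
            f (Fin.append x₁ (bxor (Pi.single i true) (Pi.single j' true)))) &&
          (f (Fin.append x₁ zeroVec) ^^ f (Fin.append x₁ (Pi.single j true)) ^^ f (Fin.append x₁ (Pi.single i' true)) ^^
            f (Fin.append x₁ (bxor (Pi.single j true) (Pi.single i' true)))))) = false)
    (hpq : (f (Fin.append x₁ zeroVec) ^^ f (Fin.append x₁ (Pi.single p true)) ^^ f (Fin.append x₁ (Pi.single q true)) ^^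
      f (Fin.append x₁ (bxor (Pi.single p true) (Pi.single q true)))) = true) :
    ∀ x₂, f (Fin.append x₁ x₂) =
      ((l (fun j => f (Fin.append x₁ zeroVec) ^^ f (Fin.append x₁ (Pi.single p true)) ^^
            f (Fin.append x₁ (Pi.single j true)) ^^ f (Fin.append x₁ (bxor (Pi.single p true) (Pi.single j true)))) x₂ &&
        l (fun j => f (Fin.append x₁ zeroVec) ^^ f (Fin.append x₁ (Pi.single q true)) ^^
            f (Fin.append x₁ (Pi.single j true)) ^^ f (Fin.append x₁ (bxor (Pi.single q true) (Pi.single j true)))) x₂) ^^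
      l (fun j => f (Fin.append x₁ (Pi.single j true)) ^^ f (Fin.append x₁ zeroVec) ^^
        ((f (Fin.append x₁ zeroVec) ^^ f (Fin.append x₁ (Pi.single p true)) ^^
            f (Fin.append x₁ (Pi.single j true)) ^^ f (Fin.append x₁ (bxor (Pi.single p true) (Pi.single j true)))) &&
         (f (Fin.append x₁ zeroVec) ^^ f (Fin.append x₁ (Pi.single q true)) ^^
            f (Fin.append x₁ (Pi.single j true)) ^^ f (Fin.append x₁ (bxor (Pi.single q true) (Pi.single j true)))))) x₂ ^^
      f (Fin.append x₁ zeroVec)) := by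
  exact acq_normalForm (c := fun x₂ => f (Fin.append x₁ x₂)) l hq hl p q hP hpq

/-- The two rows are non-zero and distinct when `B_{pq} = 1` (`B` symmetric with zero diagonal). -/
theorem acy_rows_indep
    (hpq : (f (Fin.append x₁ zeroVec) ^^ f (Fin.append x₁ (Pi.single p true)) ^^ f (Fin.append x₁ (Pi.single q true)) ^^
      f (Fin.append x₁ (bxor (Pi.single p true) (Pi.single q true)))) = true) :
    (fun j => f (Fin.append x₁ zeroVec) ^^ f (Fin.append x₁ (Pi.single p true)) ^^
        f (Fin.append x₁ (Pi.single j true)) ^^ f (Fin.append x₁ (bxor (Pi.single p true) (Pi.single j true)))) ≠ zeroVec ∧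
    (fun j => f (Fin.append x₁ zeroVec) ^^ f (Fin.append x₁ (Pi.single q true)) ^^
        f (Fin.append x₁ (Pi.single j true)) ^^ f (Fin.append x₁ (bxor (Pi.single q true) (Pi.single j true)))) ≠ zeroVec ∧
    (fun j => f (Fin.append x₁ zeroVec) ^^ f (Fin.append x₁ (Pi.single p true)) ^^
        f (Fin.append x₁ (Pi.single j true)) ^^ f (Fin.append x₁ (bxor (Pi.single p true) (Pi.single j true)))) ≠
    (fun j => f (Fin.append x₁ zeroVec) ^^ f (Fin.append x₁ (Pi.single q true)) ^^
        f (Fin.append x₁ (Pi.single j true)) ^^ f (Fin.append x₁ (bxor (Pi.single q true) (Pi.single j true)))) := by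
  have hqp : (f (Fin.append x₁ zeroVec) ^^ f (Fin.append x₁ (Pi.single q true)) ^^ f (Fin.append x₁ (Pi.single p true)) ^^
      f (Fin.append x₁ (bxor (Pi.single q true) (Pi.single p true)))) = true := by
    rw [bxor_comm (Pi.single q true)]
    revert hpq
    cases f (Fin.append x₁ zeroVec) <;> cases f (Fin.append x₁ (Pi.single q true)) <;>
      cases f (Fin.append x₁ (Pi.single p true)) <;> cases f (Fin.append x₁ (bxor (Pi.single p true) (Pi.single q true))) <;>
      decide
  have hpp : (f (Fin.append x₁ zeroVec) ^^ f (Fin.append x₁ (Pi.single p true)) ^^ f (Fin.append x₁ (Pi.single p true)) ^^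
      f (Fin.append x₁ (bxor (Pi.single p true) (Pi.single p true)))) = false := by
    rw [bxor_self]
    cases f (Fin.append x₁ zeroVec) <;> cases f (Fin.append x₁ (Pi.single p true)) <;> rfl
  refine ⟨fun h => ?_, fun h => ?_, fun h => ?_⟩
  · have hq' : (f (Fin.append x₁ zeroVec) ^^ f (Fin.append x₁ (Pi.single p true)) ^^ f (Fin.append x₁ (Pi.single q true)) ^^
        f (Fin.append x₁ (bxor (Pi.single p true) (Pi.single q true)))) = false := congrFun h q
    rw [hpq] at hq'
    exact Bool.noConfusion hq'
  · have hp' : (f (Fin.append x₁ zeroVec) ^^ f (Fin.append x₁ (Pi.single q true)) ^^ f (Fin.append x₁ (Pi.single p true)) ^^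
        f (Fin.append x₁ (bxor (Pi.single q true) (Pi.single p true)))) = false := congrFun h p
    rw [hqp] at hp'
    exact Bool.noConfusion hp'
  · have hp' : (f (Fin.append x₁ zeroVec) ^^ f (Fin.append x₁ (Pi.single p true)) ^^ f (Fin.append x₁ (Pi.single p true)) ^^
        f (Fin.append x₁ (bxor (Pi.single p true) (Pi.single p true)))) =
        (f (Fin.append x₁ zeroVec) ^^ f (Fin.append x₁ (Pi.single q true)) ^^ f (Fin.append x₁ (Pi.single p true)) ^^
        f (Fin.append x₁ (bxor (Pi.single q true) (Pi.single p true)))) := congrFun h p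
    rw [hpp, hqp] at hp'
    exact Bool.noConfusion hp'

end OffZ

/-! ### Fibre sums of a quadratic slice: rank two (off `Z`) and affine (on `Z`) — abstract form -/

section Abstract

variable {k : ℕ} (l : (Fin k → Bool) → (Fin k → Bool) → Bool) {c : (Fin k → Bool) → Bool}
  (B : Fin k → Fin k → Bool)

/-- **Fibre sum off `Z`.** For a quadratic `c` whose polar entries `B` satisfy Plücker and `B_{pq} = 1`, the Walsh
transform has modulus `2^k/2` on four corners and `0` elsewhere, so `Σ_{y∈S} ±W(y) ≤ 4·2^k/2` for every finset `S`
and every choice of signs. [cite: Carlet2020, §5.1] -/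
theorem acy_gamma_rankTwo (hl : ∀ y x, signOf (l y x) = twist x y) (hc : IsDegLeFun 2 c)
    (hB : ∀ i j, B i j = (c zeroVec ^^ c (Pi.single i true) ^^ c (Pi.single j true) ^^ c (bxor (Pi.single i true) (Pi.single j true))))
    (hP : ∀ i j i' j', ((B i j && B i' j') ^^ (B i i' && B j j') ^^ (B i j' && B j i')) = false) {p q : Fin k}
    (hpq : B p q = true) (S : Finset (Fin k → Bool)) (σ : (Fin k → Bool) → ℝ) (hσ : ∀ y, |σ y| = 1) :
    ∑ y ∈ S, σ y * W (fun x => signOf (c x)) y ≤ 4 * ((2 : ℝ) ^ k / 2) := by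
  have hP' := hP
  simp only [hB] at hP' 
  have hpq' := hpq
  rw [hB] at hpq'
  have nf := acq_normalForm l hc hl p q hP' hpq'
  -- rows and corner in `B`-notation
  have hBsymm : ∀ i j, B i j = B j i := fun i j => by
    rw [hB, hB, bxor_comm (Pi.single i true)]
    cases c zeroVec <;> cases c (Pi.single i true) <;> cases c (Pi.single j true) <;>
      cases c (bxor (Pi.single j true) (Pi.single i true)) <;> decide
  have hBdiag : ∀ i, B i i = false := fun i => by
    rw [hB, bxor_self]; cases c zeroVec <;> cases c (Pi.single i true) <;> decide
  have hrow : ∀ i, (fun j => c zeroVec ^^ c (Pi.single i true) ^^ c (Pi.single j true) ^^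
      c (bxor (Pi.single i true) (Pi.single j true))) = fun j => B i j := fun i => funext fun j => (hB i j).symm
  rw [hrow p, hrow q] at nf
  have hu : (fun j => B p j) ≠ zeroVec := fun h => by
    have := congrFun h q; rw [hpq] at this; exact Bool.noConfusion this
  have hv : (fun j => B q j) ≠ zeroVec := fun h => by
    have := congrFun h p; rw [hBsymm q p, hpq] at this; exact Bool.noConfusion this
  have huv : (fun j => B p j) ≠ (fun j => B q j) := fun h => by
    have := congrFun h p; rw [hBdiag p, hBsymm q p, hpq] at this; exact Bool.noConfusion this
  have habs := acy_W_aligned_abs l hl nf hu hv huv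
  refine acy_sum_le_of_abs S _ _ σ ((2 : ℝ) ^ k / 2) (by positivity) hσ habs ?_
  exact (card_insert_le _ _).trans (Nat.succ_le_succ ((card_insert_le _ _).trans
    (Nat.succ_le_succ ((card_insert_le _ _).trans (Nat.succ_le_succ (card_singleton _).le)))))

/-- `l 0 = 0`: the linear form of the zero vector vanishes. -/
theorem acy_lin_zero (hl : ∀ y x, signOf (l y x) = twist x y) (x : Fin k → Bool) : l zeroVec x = false :=
  acq_signOf_inj _ _ (by rw [hl, twist_zeroVec_right]; rfl)

/-- **Fibre sum on `Z`.** If every polar entry of the quadratic `c` vanishes, `c` is affine, its Walsh transform is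
`± 2^k` at a single point and `0` elsewhere, so `Σ_{y∈S} ±W(y) ≤ 2^k`. [cite: ODonnell2014, §1.4] -/
theorem acy_gamma_zero (hl : ∀ y x, signOf (l y x) = twist x y) (hc : IsDegLeFun 2 c)
    (hB : ∀ i j, B i j = (c zeroVec ^^ c (Pi.single i true) ^^ c (Pi.single j true) ^^ c (bxor (Pi.single i true) (Pi.single j true))))
    (hZ : ∀ i j, B i j = false) (S : Finset (Fin k → Bool)) (σ : (Fin k → Bool) → ℝ) (hσ : ∀ y, |σ y| = 1) :
    ∑ y ∈ S, σ y * W (fun x => signOf (c x)) y ≤ (2 : ℝ) ^ k := by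
  have lin := fun y => fc_lin_props (hl y)
  -- the polar form vanishes identically
  have hpol0 : ∀ s t, (c zeroVec ^^ c s ^^ c t ^^ c (bxor s t)) = false := by
    intro s t
    rw [acq_polar_row l hc hl s t]
    have hrow : (fun j => c zeroVec ^^ c s ^^ c (Pi.single j true) ^^ c (bxor s (Pi.single j true))) = zeroVec := by
      funext j
      have e1 : (c zeroVec ^^ c s ^^ c (Pi.single j true) ^^ c (bxor s (Pi.single j true))) =
          (c zeroVec ^^ c (Pi.single j true) ^^ c s ^^ c (bxor (Pi.single j true) s)) := by
        rw [bxor_comm s]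
        cases c zeroVec <;> cases c s <;> cases c (Pi.single j true) <;> cases c (bxor (Pi.single j true) s) <;> decide
      rw [e1, acq_polar_row l hc hl (Pi.single j true) s]
      have hrow' : (fun i => c zeroVec ^^ c (Pi.single j true) ^^ c (Pi.single i true) ^^
          c (bxor (Pi.single j true) (Pi.single i true))) = zeroVec := funext fun i => by rw [← hB]; exact hZ j i
      rw [hrow', acy_lin_zero l hl]
      rfl
    rw [hrow, acy_lin_zero l hl]
  -- D x := c x ⊕ c 0 is additive, hence the linear form of a″_j := c e_j ⊕ c 0
  have hadd : ∀ x t, (c (bxor x t) ^^ c zeroVec) = ((c x ^^ c zeroVec) ^^ (c t ^^ c zeroVec)) := by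
    intro x t
    have := hpol0 x t
    revert this
    cases c zeroVec <;> cases c x <;> cases c t <;> cases c (bxor x t) <;> decide
  have hD : ∀ x, (c x ^^ c zeroVec) = l (fun j => c (Pi.single j true) ^^ c zeroVec) x :=
    acq_additive_ext (L := fun x => c x ^^ c zeroVec) hadd (lin (fun j => c (Pi.single j true) ^^ c zeroVec)).1
      (fun i => by rw [(lin _).2.1])
  have hc' : ∀ x, c x = (l (fun j => c (Pi.single j true) ^^ c zeroVec) x ^^ c zeroVec) := by
    intro x
    have := hD x
    generalize l (fun j => c (Pi.single j true) ^^ c zeroVec) x = lx at this ⊢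
    revert this
    cases c x <;> cases c zeroVec <;> cases lx <;> decide
  have hW := acq_W_affine l hl hc'
  calc ∑ y ∈ S, σ y * W (fun x => signOf (c x)) y ≤ ∑ y ∈ S, |σ y * W (fun x => signOf (c x)) y| :=
        sum_le_sum fun y _ => le_abs_self _
    _ = ∑ y ∈ S, (if y = (fun j => c (Pi.single j true) ^^ c zeroVec) then (2 : ℝ) ^ k else 0) := by
        refine sum_congr rfl fun y _ => ?_
        rw [abs_mul, hσ, one_mul, hW y, abs_mul, abs_mul, abs_signOf, mul_one, abs_of_pos (by positivity)]
        split_ifs <;> simp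
    _ = ((S.filter fun y => y = (fun j => c (Pi.single j true) ^^ c zeroVec)).card : ℝ) * (2 : ℝ) ^ k := by
        rw [← sum_filter, sum_const, nsmul_eq_mul]
    _ ≤ 1 * (2 : ℝ) ^ k := by
        refine mul_le_mul_of_nonneg_right ?_ (by positivity)
        have : (S.filter fun y => y = (fun j => c (Pi.single j true) ^^ c zeroVec)).card ≤ 1 :=
          card_le_one.2 fun y hy z hz => by rw [(mem_filter.1 hy).2, (mem_filter.1 hz).2]
        exact_mod_cast this
    _ = (2 : ℝ) ^ k := one_mul _

end Abstract

/-- **Fibre sum on `Z`** (registered helper-stub form of `acy_gamma_zero`). [cite: ODonnell2014, §1.4] -/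
theorem acy_gammaZeroStub : ∀ {k : ℕ} (l : (Fin k → Bool) → (Fin k → Bool) → Bool) {c : (Fin k → Bool) → Bool} (B : Fin k → Fin k → Bool), (∀ y x, signOf (l y x) = twist x y) → IsDegLeFun 2 c → (∀ i j, B i j = (c zeroVec ^^ c (Pi.single i true) ^^ c (Pi.single j true) ^^ c (bxor (Pi.single i true) (Pi.single j true)))) → (∀ i j, B i j = false) → ∀ (S : Finset (Fin k → Bool)) (σ : (Fin k → Bool) → ℝ), (∀ y, |σ y| = 1) → ∑ y ∈ S, σ y * W (fun x => signOf (c x)) y ≤ (2 : ℝ) ^ k := by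
  intro k l c B hl hc hB hZ S σ hσ
  exact acy_gamma_zero l B hl hc hB hZ S σ hσ

end Summit.QuantumAdvantage.QuantumAdvantage.Theorems.CubicForrelation.NearExactIsExact

end
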